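import Mathlib
import Literature.MathematicalPhysics.QuantumFieldTheory.Balaban1983to89.TreeLength

/-!
# `Balaban1983to89.B13WalkCubes111` — [Balaban1988RG2Cluster] p. 5, the geometric sentence after (1.11)
(*"If m is big enough, for example m > 2⁴, then δ₀d(ω) ≧ δ₁mM"*): a kernel-checked REPAIRED form with an explicit
size threshold and an explicit δ₁, and a kernel-checked COUNTEREXAMPLE to the sentence as printed (no threshold)

CITATION HEADER (lean-in-tree rule 2026-08-18).  Source under audit: T. Bałaban, *Renormalization group approach to
lattice gauge field theories. II. Cluster expansions*, Commun. Math. Phys. **116**, 1–22 (1988),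
doi:10.1007/bf01239022 [Balaban1988RG2Cluster] (cell paper B13; held `paper:balaban1988-cmp116-rg-ii-cluster`,
journal page = PDF page).  Quotations were read from the page renders
`HOME/b2b-balaban-ref1/pages/1988-cmp116-rg-II-cluster/1988-cmp116-rg-II-cluster-p003-x2.png` and `…-p005-x2.png`
(images, this unit).  Published input quoted for CONTEXT ONLY (nothing of it is used as a hypothesis): T. Bałaban,
*Propagators for lattice gauge theories in a background field*, Commun. Math. Phys. **99**, 389–434 (1985)
[Balaban1985BackgroundPropagators] (cell paper B9 = reference [13] of B13), p. 410 (3.93) and p. 413 (renders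
`…/1985-cmp99-background-propagators-p022-x2.png`, `…-p025-x2.png`).  Sibling of `…Balaban1983to89.TreeLength`
(unit pv22), imported for the continuum model (closed unit cubes `cube y`, y ∈ ℤ^d, of the rescaled space ℝ^d with
the sup metric; polygonal graphs `List (Seg d)` with `carrier`, `len`; the CAPTURE LEMMA `le_lenIn_closedBall` and
the additivity `sum_lenIn_le_len` of Parts 5–6 there) and for the proof template `card_le_of_sAdmissible`
(Part 7 there); nothing existing is modified (`…Balaban1983to89.B13` untouched).  Cell records: GAPS.md G-adv4-22
(the located objection this module answers, unit adv4-g19), C-adv4-47, C-B13-01 (owner transcript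
`HOME/b2b-balaban-b13/transcript-B13.md` l. 37, whose CHECK used the wrong count — erratum recorded with this
module), restriction census R1 (δ₁M ≧ κ₁); unit `b2b-balaban-b13-g7`.

THE TEXT.  [Balaban1988RG2Cluster] p. 3, verbatim: *"X₀, X₁, …, X_n are simple localization domains, unions of
connected families containing several cubes from π_k(1), i.e. of the size M₁ instead of M"*; *"To construct the
decoupling we introduce a regular partition σ_k of the space T, in the scale corresponding to the lattice T_η, into
cubes Δ of the size R₁M₁. The number R₁ is a power of L satisfying the condition R₁M₁M⁻¹ ≦ 1. For the particular
example under consideration we take cubes of the size M, which are disjoint with the interior of □̃⁴. We denote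
this family by σ₀."*; *"for a random walk ω localized in X̃₀⁵ ∪ X̃₁⁵ ∪ ⋯ ∪ X̃_n⁵ we take the {Δ₁, …, Δ_m} of all cubes
from σ₀ which intersect this localization domain, and we multiply the term in (1.6) corresponding to ω by
s(Δ₁)⋯s(Δ_m)."*  P. 5, (1.11): *"B₀|X| sup_ω M₁^{−1/2|ω|} exp(−δ₀d(ω)) e^{mκ₁}, where d(ω) is a length of a
shortest tree graph intersecting all localization domains of ω, m is the number of the parameters s connected
with the walk ω. If m is big enough, for example m > 2⁴, then δ₀d(ω) ≧ δ₁mM, for a positive constant δ₁ depending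
on δ₀ only, and we can bound the expression under the supremum in (1.11) by 1, for δ₁M ≧ κ₁. If m ≦ 2⁴, then we
can have short walks, in fact with |ω| = 0, and the expression can be bounded by e^{16κ₁} only. Thus the function
H(s(Y₀))X is an analytic function of the variables s(Y₀) on the domain |s(Y₀)| ≦ e^{κ₁}, bounded by B₀e^{16κ₁}|X|
in all norms of Theorems 3.1.-3.10 [13]."*  Context, [Balaban1985BackgroundPropagators] p. 413, verbatim: *"We
consider only very small families, containing several cubes. A biggest is connected with operators localized in
□₀, which is a sum of 5^d cubes from 𝒟."*; p. 410 (3.93): *"d(ω, y, y′) = inf_{(y₁,…,y_n)} (d(y, y₁) + d(y₁, y₂) + ⋯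
+ d(y_{n−1}, y_n) + d(y_n, y′)), the infimum is taken over all sequences (y₁, …, y_n) of points y_i ∈ □_i ∈ 𝔅"*
(a PATH through the domains in walk order, where B13 p. 5 says "shortest tree graph" — both readings are covered
below, since the bound proved holds for EVERY connected polygonal graph meeting all the domains).

THE MODEL (rescale by M, as in `…TreeLength`: σ₀-cubes = closed unit cubes `cube y`, y ∈ ℤ^d; lengths in M-units).
A walk's localization domains are an arbitrary family `X : ι → Set (RPt d)` with thickened domains `Xt j ⊇ X j`
(the X̃⁵_j) each of sup-diameter ≤ τ (τ = thickness parameter in M-units; for families of ≤ 5^d cubes of size M₁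
in a 5-block with five M₁-layers added, τ = 15M₁/M — the diameter is NOT printed as a number in B13/B9, so τ is
kept as a parameter); a "tree graph intersecting all localization domains" is a polygonal graph T with connected
carrier meeting every X j (`WAdmissible X T`, convention (ii) of `…TreeLength`: connected finite unions of
segments in place of trees — the printed shortest tree is one of them, so every lower bound proved for all of them
holds for d(ω)); the cubes carrying parameters s are any finite set Y of unit cubes each meeting some Xt j; m = |Y|.

WHAT THIS MODULE PROVES (all `theorem`s kernel-checked, no `sorry`, no new axioms).
 * Part 1 — THE SOURCE OF 2⁴: a set lying in a coordinate box of side < 1 (in particular a set of sup-diameter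
   τ < 1, or the r-neighbourhood of a point with 2r < 1) meets at most 2^d closed unit cubes
   (`card_le_two_pow_of_box`, `card_le_two_pow_of_diam`, `card_le_two_pow_of_near`).
 * Part 2 — THE COUNTING THEOREM (separated-net argument of `TreeLength.card_le_of_sAdmissible`, generalised from
   "T meets every cube of Y" to "every cube of Y comes within τ of T"): `NearAdmissible τ Y T` ⟹
   |Y| ≤ 2^d · max(1, |T|/ρ) for every ρ > 0 with 4ρ + 2τ < 1 (`card_le_of_nearAdmissible`), hence the DICHOTOMY
   `card_dichotomy_of_nearAdmissible`: if 2τ < 1 then |Y| ≤ 2^d or (1 − 2τ)|Y| ≤ 4·2^d·|T|.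
 * Part 3 — THE WALK SETTING: `nearAdmissible_of_wAdmissible` (domains of diameter ≤ τ met by T put every cube
   meeting them within τ of T), `walkCubes_dichotomy` (m ≤ 2^d or (1 − 2τ)m ≤ 4·2^d·|T| for every admissible T),
   `walkCubes_dichotomy_walkLen` (the same with the infimum `walkLen X` = d(ω)/M), `card_le_two_pow_single`
   (one thickened domain of diameter < 1 meets ≤ 2^d cubes: the |ω| = 0 case).
 * Part 4 — THE REPAIRED SENTENCE IN PAPER UNITS, with δ₁ := δ₀(1 − 2τ)/(4·2^d) (`delta1`; d = 4:
   δ₀(1 − 2τ)/64, `delta1_four`; τ ≤ 1/6 ⟹ δ₁ ≥ δ₀/96, `delta1_four_sixth`; τ ≤ 1/4 ⟹ δ₁ ≥ δ₀/128,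
   `delta1_four_quarter`): m > 2^d ⟹ δ₁mM ≤ δ₀d(ω) (`ineq111_long`); under the restriction R1 = δ₁M ≥ κ₁ the
   factor exp(−δ₀d(ω) + mκ₁) under the supremum in (1.11) is ≤ 1 for m > 2^d (`supFactor_le_one`) and ≤ e^{2^d κ₁}
   for m ≤ 2^d (`supFactor_le_short`), so ≤ e^{2^d κ₁} always (`supFactor_le`, `ineq111_repaired`; d = 4:
   e^{16κ₁}, `ineq111_repaired_four`) — i.e. the printed CONCLUSION "bounded by B₀e^{16κ₁}|X|" survives under the
   UNPRINTED threshold 2τ < 1 (thickened domains of sup-diameter < M/2), with δ₁ depending on δ₀, d AND τ.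
 * Part 5 — THE SENTENCE AS PRINTED FAILS WITHOUT A THRESHOLD (`printed111_counterexample`, `printed111_fails`):
   one domain X₀ = X̃₀⁵ = the block [0, n]^d (n ≥ 1, d ≥ 1), the one-point graph at a point of X₀ (so d(ω) = 0,
   `walkLen_block`), and the (n + 2)^d > 2^d unit cubes meeting the block: m > 2^d while δ₀d(ω) = 0 < δ₁mM for
   every δ₁ > 0; the instance admitted by p. 3 with R₁ = 1 (M₁ = M, X₀ = □₀ of 5⁴ M₁-cubes, X̃₀⁵ a 15-block) is
   d = 4, n = 15, m = 17⁴ = 83521 (`card_blockCubes_B13`) — the exact count of the cell's engine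
   `HOME/b2b-balaban-adv4/g19/engine_b13_111.py` part B, now a kernel theorem.
 * Part 6 — THE PATH READING of [Balaban1985BackgroundPropagators] (3.93): the polygonal path through one point
   per domain is admissible (`wAdmissible_pathGraph`), so the dichotomy holds with the (3.93) path length in place
   of the tree length (`walkCubes_dichotomy_path`).

SCOPE (candid).  Proved: elementary geometry/arithmetic in the rescaled continuum model of `…TreeLength` (sup
metric of [Dimock2013BalabanII] App. E; closed cubes; connected polygonal graphs for trees).  NOT asserted: the
value of τ for Bałaban's domains (B9 p. 413 bounds the families by 5^d cubes; the diameter of X̃⁵_j is not printed),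
nor that δ₁ = δ₀(1 − 2τ)/(4·2^d) or the cell's δ₀/96 is Bałaban's δ₁ (none is printed), nor anything about the
random-walk expansion (1.6)–(1.7) itself (operators, norms, B₀): the module isolates the one geometric inequality
and the real arithmetic of the case split.  The threshold 2τ < 1 is OURS (a sufficient condition; the cell's
alternative derivation, GAPS G-adv4-22 (3), uses τ < 1/4 and tree cutting and is not reproduced); B13 prints no
M/M₁ inequality (p. 3 admits R₁ = 1) and B12 p. 257 has only *"we choose the size M much bigger than the previously
fixed scales"*.  Value: kernel-checked certificate for a located gap of the manuscript under audit (repair +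
refutation-as-printed of one sentence whose printed conclusion survives), NOT summit progress.
-/

noncomputable section

namespace Literature.MathematicalPhysics.QuantumFieldTheory.Balaban1983to89.B13WalkCubes111

open Literature.MathematicalPhysics.QuantumFieldTheory.Balaban1983to89
open Literature.MathematicalPhysics.QuantumFieldTheory.Balaban1983to89.B13ScaleTransfer
open Literature.MathematicalPhysics.QuantumFieldTheory.Balaban1983to89.TreeLength
open MeasureTheory

variable {d : ℕ}

/-! ## Part 1. Cube counting in a thin box — the source of the printed 2⁴ -/

/-- BOX COUNT: if every cube of Y has a point in one coordinate box ∏_μ [a_μ, a_μ + τ] of side τ < 1, then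
|Y| ≤ 2^d (coordinatewise, y_μ ∈ [a_μ − 1, a_μ + τ] contains at most two integers).  This is where the printed
*"2⁴"* of [Balaban1988RG2Cluster] p. 5 comes from (d = 4). [cite: Balaban1988RG2Cluster, p.5 after (1.11)] -/
theorem card_le_two_pow_of_box {Y : Finset (Pt d)} {a : RPt d} {τ : ℝ} (hτ : τ < 1)
    (h : ∀ y ∈ Y, ∃ q ∈ cube y, ∀ μ, a μ ≤ q μ ∧ q μ ≤ a μ + τ) : Y.card ≤ 2 ^ d := by
  classical
  set m : Fin d → ℤ := fun μ => ⌈a μ - 1⌉ with hm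
  have hsub : Y ⊆ Fintype.piFinset fun μ => ({m μ, m μ + 1} : Finset ℤ) := by
    intro y hy
    obtain ⟨q, hq, hqa⟩ := h y hy
    rw [Fintype.mem_piFinset]
    intro μ
    have hc := (mem_cube.1 hq) μ
    have ha := hqa μ
    have h1 : a μ - 1 ≤ (y μ : ℝ) := by linarith [hc.2, ha.1]
    have h2 : ((y μ : ℤ) : ℝ) < (m μ : ℝ) + 2 := by
      have := Int.le_ceil (a μ - 1)
      linarith [hc.1, ha.2]
    have hm1 : m μ ≤ y μ := Int.ceil_le.2 h1
    have hm2 : y μ < m μ + 2 := by exact_mod_cast h2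
    rw [Finset.mem_insert, Finset.mem_singleton]
    omega
  have hbox : (Fintype.piFinset fun μ => ({m μ, m μ + 1} : Finset ℤ)).card = 2 ^ d := by
    rw [Fintype.card_piFinset, Finset.prod_congr rfl (fun μ _ => Finset.card_pair (by omega : m μ ≠ m μ + 1)),
      Finset.prod_const, Finset.card_univ, Fintype.card_fin]
  have := Finset.card_le_card hsub
  rwa [hbox] at this

/-- NEAR-POINT COUNT: at most 2^d closed unit cubes come within sup-distance r of a point when 2r < 1.
[cite: Balaban1988RG2Cluster, p.5 after (1.11)] -/
theorem card_le_two_pow_of_near {Y : Finset (Pt d)} {p : RPt d} {r : ℝ} (hr : 2 * r < 1)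
    (h : ∀ y ∈ Y, ∃ q ∈ cube y, dist q p ≤ r) : Y.card ≤ 2 ^ d := by
  refine card_le_two_pow_of_box (a := fun μ => p μ - r) (τ := 2 * r) hr fun y hy => ?_
  obtain ⟨q, hq, hqp⟩ := h y hy
  refine ⟨q, hq, fun μ => ?_⟩
  have hdμ : dist (q μ) (p μ) ≤ r := (dist_le_pi_dist q p μ).trans hqp
  rw [Real.dist_eq, abs_le] at hdμ
  show p μ - r ≤ q μ ∧ q μ ≤ p μ - r + 2 * r
  exact ⟨by linarith [hdμ.1], by linarith [hdμ.2]⟩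

/-- DIAMETER COUNT (the cell's Lemma A of GAPS G-adv4-22 (3), there checked exhaustively for d = 4, M = 8): a set
of sup-diameter ≤ τ < 1 meets at most 2^d closed unit cubes. [cite: Balaban1988RG2Cluster, p.5 after (1.11)] -/
theorem card_le_two_pow_of_diam {Y : Finset (Pt d)} {D : Set (RPt d)} {τ : ℝ} (hτ : τ < 1)
    (hD : ∀ p ∈ D, ∀ q ∈ D, dist p q ≤ τ) (h : ∀ y ∈ Y, (cube y ∩ D).Nonempty) : Y.card ≤ 2 ^ d := by
  classical
  rcases Y.eq_empty_or_nonempty with rfl | ⟨y₀, hy₀⟩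
  · simp
  obtain ⟨p₀, -, hp₀⟩ := h y₀ hy₀
  have hbdd : ∀ μ : Fin d, BddBelow ((fun q : RPt d => q μ) '' D) := by
    intro μ
    refine ⟨p₀ μ - τ, ?_⟩
    rintro _ ⟨q, hq, rfl⟩
    have hqμ := (dist_le_pi_dist q p₀ μ).trans (hD q hq p₀ hp₀)
    rw [Real.dist_eq, abs_le] at hqμ
    show p₀ μ - τ ≤ q μ
    linarith [hqμ.1]
  refine card_le_two_pow_of_box (a := fun μ => sInf ((fun q : RPt d => q μ) '' D)) hτ fun y hy => ?_
  obtain ⟨q, hqc, hqD⟩ := h y hy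
  refine ⟨q, hqc, fun μ => ⟨csInf_le (hbdd μ) ⟨q, hqD, rfl⟩, ?_⟩⟩
  have hle : q μ - τ ≤ sInf ((fun q : RPt d => q μ) '' D) := by
    refine le_csInf ⟨p₀ μ, p₀, hp₀, rfl⟩ ?_
    rintro _ ⟨q', hq', rfl⟩
    have hqμ := (dist_le_pi_dist q q' μ).trans (hD q hqD q' hq')
    rw [Real.dist_eq, abs_le] at hqμ
    show q μ - τ ≤ q' μ
    linarith [hqμ.2]
  show q μ ≤ sInf ((fun q : RPt d => q μ) '' D) + τ
  linarith

/-! ## Part 2. Near-admissible graphs and the counting theorem (separated net + capture lemma) -/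

/-- NEAR-ADMISSIBILITY at thickness τ: the graph T is connected and every cube of Y has a point within
sup-distance τ of T.  For τ = 0 this is `TreeLength.SAdmissible` (T meets every cube of Y); in the walk setting of
[Balaban1988RG2Cluster] p. 3/p. 5 the cubes Δ_i meet the thickened domains X̃⁵_j, which the tree meets, so τ = the
sup-diameter of the X̃⁵_j (`nearAdmissible_of_wAdmissible`). [cite: Balaban1988RG2Cluster, p.5 after (1.11)] -/
structure NearAdmissible (τ : ℝ) (Y : Finset (Pt d)) (T : List (Seg d)) : Prop where
  /-- the graph is connected -/
  connected : IsConnected (carrier T)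
  /-- every cube of Y comes within τ of the graph -/
  near : ∀ y ∈ Y, ∃ z ∈ carrier T, ∃ q ∈ cube y, dist q z ≤ τ

/-- A Steiner-admissible graph is near-admissible at every thickness τ ≥ 0. [folklore] -/
theorem nearAdmissible_of_sAdmissible {Y : Finset (Pt d)} {T : List (Seg d)} (h : SAdmissible Y T) {τ : ℝ}
    (hτ : 0 ≤ τ) : NearAdmissible τ Y T := by
  refine ⟨h.connected, fun y hy => ?_⟩
  obtain ⟨z, hzT, hzc⟩ := h.meets y hy
  exact ⟨z, hzT, z, hzc, by rw [dist_self]; exact hτ⟩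

/-- Near-admissibility is monotone in the thickness. [folklore] -/
theorem NearAdmissible.mono {τ τ' : ℝ} {Y : Finset (Pt d)} {T : List (Seg d)} (h : NearAdmissible τ Y T)
    (hle : τ ≤ τ') : NearAdmissible τ' Y T := by
  refine ⟨h.connected, fun y hy => ?_⟩
  obtain ⟨z, hzT, q, hq, hqz⟩ := h.near y hy
  exact ⟨z, hzT, q, hq, hqz.trans hle⟩

/-- Near-admissibility is monotone (decreasing) in the cube set. [folklore] -/
theorem NearAdmissible.subset {τ : ℝ} {Y Y' : Finset (Pt d)} {T : List (Seg d)} (h : NearAdmissible τ Y T)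
    (hY : Y' ⊆ Y) : NearAdmissible τ Y' T :=
  ⟨h.connected, fun y hy => h.near y (hY hy)⟩

/-- THE COUNTING THEOREM at separation scale ρ > 0 with 4ρ + 2τ < 1: if T is near-admissible for Y at thickness τ
then |Y| ≤ 2^d · max(1, |T|/ρ).  Proof (the separated-net argument of `TreeLength.card_le_of_sAdmissible`, with
the one change that witnesses lie within τ of their cubes): choose for each y ∈ Y a witness P_y ∈ T within τ of a
point Q_y ∈ □_y, and a maximal subfamily S whose witnesses are pairwise > 2ρ apart; every y has its witness within
2ρ of a witness of S, and the cubes whose witness is within 2ρ of a given point have a point within 2ρ + τ of it,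
so they number ≤ 2^d (`card_le_two_pow_of_near`, 2(2ρ + τ) < 1); hence |Y| ≤ 2^d|S|; if |S| ≥ 2 the closed balls
B̄(P_y, ρ), y ∈ S, are pairwise disjoint and each captures length ≥ ρ of the connected T (capture lemma
`TreeLength.le_lenIn_closedBall`), so |S|ρ ≤ |T|. [cite: Balaban1988RG2Cluster, p.5 after (1.11)] -/
theorem card_le_of_nearAdmissible {τ : ℝ} {Y : Finset (Pt d)} {T : List (Seg d)} (hT : NearAdmissible τ Y T)
    {ρ : ℝ} (hρ : 0 < ρ) (h4 : 4 * ρ + 2 * τ < 1) : (Y.card : ℝ) ≤ 2 ^ d * max 1 (len T / ρ) := by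
  classical
  have hw : ∀ y ∈ Y, ∃ z q : RPt d, z ∈ carrier T ∧ q ∈ cube y ∧ dist q z ≤ τ := fun y hy => by
    obtain ⟨z, hz, q, hq, hqz⟩ := hT.near y hy
    exact ⟨z, q, hz, hq, hqz⟩
  choose! P Q hPT hQc hQP using hw
  obtain ⟨S, hSmem, hSmax⟩ := (Y.powerset.filter fun S : Finset (Pt d) =>
      ∀ a ∈ S, ∀ b ∈ S, a ≠ b → 2 * ρ < dist (P a) (P b)).exists_max_image Finset.card
    ⟨∅, by simp⟩
  rw [Finset.mem_filter, Finset.mem_powerset] at hSmem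
  obtain ⟨hSY, hSsep⟩ := hSmem
  -- covering property of the maximal separated subfamily
  have hcover : ∀ x ∈ Y, ∃ y ∈ S, dist (P x) (P y) ≤ 2 * ρ := by
    intro x hx
    by_cases hxS : x ∈ S
    · exact ⟨x, hxS, by rw [dist_self]; positivity⟩
    by_contra hfar
    push Not at hfar
    have hins : insert x S ∈ Y.powerset.filter fun S : Finset (Pt d) =>
        ∀ a ∈ S, ∀ b ∈ S, a ≠ b → 2 * ρ < dist (P a) (P b) := by
      rw [Finset.mem_filter, Finset.mem_powerset]
      refine ⟨Finset.insert_subset hx hSY, ?_⟩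
      intro a ha b hb hab
      rw [Finset.mem_insert] at ha hb
      rcases ha with rfl | ha <;> rcases hb with rfl | hb
      · exact absurd rfl hab
      · exact hfar b hb
      · rw [dist_comm]; exact hfar a ha
      · exact hSsep a ha b hb hab
    have hle := hSmax _ hins
    rw [Finset.card_insert_of_notMem hxS] at hle
    omega
  -- at most 2^d cubes have their witness within 2ρ of a given witness (their points Q lie within 2ρ + τ of it)
  have hnear : ∀ y ∈ S, ((Y.filter fun x => dist (P x) (P y) ≤ 2 * ρ).card : ℝ) ≤ 2 ^ d := by
    intro y hy
    have h2r : 2 * (2 * ρ + τ) < 1 := by linarith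
    exact_mod_cast card_le_two_pow_of_near (p := P y) h2r fun x hx => by
      rw [Finset.mem_filter] at hx
      exact ⟨Q x, hQc x hx.1, (dist_triangle (Q x) (P x) (P y)).trans (by linarith [hQP x hx.1, hx.2])⟩
  -- hence |Y| ≤ 2^d |S|
  have hYS : (Y.card : ℝ) ≤ 2 ^ d * S.card := by
    have hcov' : Y ⊆ S.biUnion (fun y => Y.filter fun x => dist (P x) (P y) ≤ 2 * ρ) := by
      intro x hx
      obtain ⟨y, hy, hxy⟩ := hcover x hx
      exact Finset.mem_biUnion.2 ⟨y, hy, Finset.mem_filter.2 ⟨hx, hxy⟩⟩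
    calc (Y.card : ℝ) ≤ ((S.biUnion fun y => Y.filter fun x => dist (P x) (P y) ≤ 2 * ρ).card : ℝ) := by
          exact_mod_cast Finset.card_le_card hcov'
      _ ≤ ∑ y ∈ S, ((Y.filter fun x => dist (P x) (P y) ≤ 2 * ρ).card : ℝ) := by
          exact_mod_cast Finset.card_biUnion_le
      _ ≤ ∑ y ∈ S, (2 : ℝ) ^ d := Finset.sum_le_sum hnear
      _ = 2 ^ d * S.card := by rw [Finset.sum_const, nsmul_eq_mul, mul_comm]
  -- and |S| ≤ max(1, |T|/ρ)
  have hS : (S.card : ℝ) ≤ max 1 (len T / ρ) := by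
    rcases Nat.lt_or_ge 1 S.card with h1 | h1
    · have hcap : ∀ y ∈ S, ρ ≤ lenIn (Metric.closedBall (P y) ρ) T := by
        intro y hy
        obtain ⟨y', hy', hne⟩ := (Finset.one_lt_card_iff_nontrivial.1 h1).exists_ne y
        have hfar : ρ ≤ dist (P y) (P y') := by
          have := hSsep y hy y' hy' hne.symm
          linarith
        exact le_lenIn_closedBall hT.connected.isPreconnected (hPT y (hSY hy)) (hPT y' (hSY hy')) hρ hfar
      have hdisj : (S : Set (Pt d)).PairwiseDisjoint (fun y => Metric.closedBall (P y) ρ) := by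
        intro a ha b hb hab
        exact Metric.closedBall_disjoint_closedBall (by have := hSsep a ha b hb hab; linarith)
      have hsum : (S.card : ℝ) * ρ ≤ len T := by
        calc (S.card : ℝ) * ρ = ∑ y ∈ S, ρ := by rw [Finset.sum_const, nsmul_eq_mul]
          _ ≤ ∑ y ∈ S, lenIn (Metric.closedBall (P y) ρ) T := Finset.sum_le_sum hcap
          _ ≤ len T := sum_lenIn_le_len S _ (fun y _ => Metric.isClosed_closedBall) hdisj T
      calc (S.card : ℝ) ≤ len T / ρ := by rw [le_div_iff₀ hρ]; exact hsum
        _ ≤ max 1 (len T / ρ) := le_max_right _ _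
    · calc (S.card : ℝ) ≤ 1 := by exact_mod_cast h1
        _ ≤ max 1 (len T / ρ) := le_max_left _ _
  calc (Y.card : ℝ) ≤ 2 ^ d * S.card := hYS
    _ ≤ 2 ^ d * max 1 (len T / ρ) := mul_le_mul_of_nonneg_left hS (by positivity)

/-- THE DICHOTOMY (the counting theorem as ρ ↑ (1 − 2τ)/4): if T is near-admissible for Y at thickness τ with
2τ < 1, then |Y| ≤ 2^d or (1 − 2τ)|Y| ≤ 4·2^d·|T| — the two cases *"m ≦ 2⁴"* / *"m > 2⁴, then δ₀d(ω) ≧ δ₁mM"* of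
[Balaban1988RG2Cluster] p. 5 in M-units, under the (unprinted) thickness threshold 2τ < 1.
[cite: Balaban1988RG2Cluster, p.5 after (1.11)] -/
theorem card_dichotomy_of_nearAdmissible {τ : ℝ} {Y : Finset (Pt d)} {T : List (Seg d)}
    (hT : NearAdmissible τ Y T) (hτ2 : 2 * τ < 1) :
    Y.card ≤ 2 ^ d ∨ (1 - 2 * τ) * Y.card ≤ 4 * 2 ^ d * len T := by
  by_cases hY : Y.card ≤ 2 ^ d
  · exact Or.inl hY
  right
  push Not at hY
  have hY' : (2 : ℝ) ^ d < Y.card := by exact_mod_cast hY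
  have hYpos : (0 : ℝ) < Y.card := lt_of_le_of_lt (by positivity) hY'
  have hℓ := len_nonneg T
  have key : ∀ ρ : ℝ, 0 < ρ → 4 * ρ + 2 * τ < 1 → ρ * Y.card ≤ 2 ^ d * len T := by
    intro ρ hρ h4
    have h := card_le_of_nearAdmissible hT hρ h4
    rcases le_or_gt (len T / ρ) 1 with hle | hlt
    · rw [max_eq_left hle] at h
      linarith
    · rw [max_eq_right hlt.le, ← mul_div_assoc] at h
      have := (le_div_iff₀ hρ).1 h
      linarith
  by_contra hcon
  push Not at hcon
  have hlt : 2 ^ d * len T / Y.card < (1 - 2 * τ) / 4 := by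
    rw [div_lt_iff₀ hYpos]
    linarith
  have hnn : 0 ≤ 2 ^ d * len T / Y.card := div_nonneg (mul_nonneg (by positivity) hℓ) hYpos.le
  have hkey := key (((1 - 2 * τ) / 4 + 2 ^ d * len T / Y.card) / 2) (by linarith) (by linarith)
  have hρlt : 2 ^ d * len T / Y.card < ((1 - 2 * τ) / 4 + 2 ^ d * len T / Y.card) / 2 := by linarith
  rw [div_lt_iff₀ hYpos] at hρlt
  linarith

/-! ## Part 3. The walk setting of [Balaban1988RG2Cluster] p. 3 / p. 5 -/

/-- WALK-ADMISSIBLE graphs for a family of localization domains (X_j)_j — [Balaban1988RG2Cluster] p. 5, verbatim: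
*"tree graph intersecting all localization domains of ω"* — convention (ii) of `…TreeLength`: the carrier is
connected and meets every X_j. [cite: Balaban1988RG2Cluster, p.5 after (1.11)] -/
structure WAdmissible {ι : Type*} (X : ι → Set (RPt d)) (T : List (Seg d)) : Prop where
  /-- the graph is connected -/
  connected : IsConnected (carrier T)
  /-- the graph intersects all localization domains -/
  meets : ∀ j, (carrier T ∩ X j).Nonempty

/-- The set of lengths of the walk-admissible graphs. [cite: Balaban1988RG2Cluster, p.5 after (1.11)] -/
def wlengths {ι : Type*} (X : ι → Set (RPt d)) : Set ℝ := {ℓ | ∃ T, WAdmissible X T ∧ len T = ℓ}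

/-- d(ω)/M — [Balaban1988RG2Cluster] p. 5, verbatim: *"d(ω) is a length of a shortest tree graph intersecting all
localization domains of ω"* — as the infimum of the lengths of the walk-admissible graphs (M-units; junk value
`sInf ∅ = 0` if no finite graph meets all the domains). [cite: Balaban1988RG2Cluster, p.5 after (1.11)] -/
def walkLen {ι : Type*} (X : ι → Set (RPt d)) : ℝ := sInf (wlengths X)

/-- Members of `wlengths X` are non-negative. [folklore] -/
theorem wlengths_nonneg {ι : Type*} {X : ι → Set (RPt d)} {ℓ : ℝ} (h : ℓ ∈ wlengths X) : 0 ≤ ℓ := by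
  obtain ⟨T, -, rfl⟩ := h
  exact len_nonneg T

/-- `wlengths X` is bounded below (by 0). [folklore] -/
theorem bddBelow_wlengths {ι : Type*} (X : ι → Set (RPt d)) : BddBelow (wlengths X) :=
  ⟨0, fun _ h => wlengths_nonneg h⟩

/-- d(ω) ≥ 0. [cite: Balaban1988RG2Cluster, p.5 after (1.11)] -/
theorem walkLen_nonneg {ι : Type*} (X : ι → Set (RPt d)) : 0 ≤ walkLen X :=
  Real.sInf_nonneg fun _ h => wlengths_nonneg h

/-- d(ω)/M is at most the length of any walk-admissible graph. [cite: Balaban1988RG2Cluster, p.5 after (1.11)] -/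
theorem walkLen_le_len {ι : Type*} {X : ι → Set (RPt d)} {T : List (Seg d)} (h : WAdmissible X T) :
    walkLen X ≤ len T :=
  csInf_le (bddBelow_wlengths X) ⟨T, h, rfl⟩

/-- A lower bound of the lengths of all walk-admissible graphs bounds d(ω)/M from below, provided the class is
non-empty. [folklore] -/
theorem le_walkLen {ι : Type*} {X : ι → Set (RPt d)} {a : ℝ} (hne : ∃ T, WAdmissible X T)
    (h : ∀ T, WAdmissible X T → a ≤ len T) : a ≤ walkLen X := by
  obtain ⟨T₀, hT₀⟩ := hne
  refine le_csInf ⟨len T₀, T₀, hT₀, rfl⟩ ?_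
  rintro _ ⟨T, hT, rfl⟩
  exact h T hT

/-- FROM THE WALK SETTING TO NEAR-ADMISSIBILITY: if the thickened domains X̃_j ⊇ X_j have sup-diameter ≤ τ, T meets
every X_j, and every cube of Y meets some X̃_j ([Balaban1988RG2Cluster] p. 3: *"the {Δ₁, …, Δ_m} of all cubes from
σ₀ which intersect this localization domain"*), then every cube of Y is within τ of T.
[cite: Balaban1988RG2Cluster, p.3 (s-dependence)] -/
theorem nearAdmissible_of_wAdmissible {ι : Type*} {X Xt : ι → Set (RPt d)} {τ : ℝ} (hXt : ∀ j, X j ⊆ Xt j)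
    (hdiam : ∀ j, ∀ p ∈ Xt j, ∀ q ∈ Xt j, dist p q ≤ τ) {T : List (Seg d)} (hT : WAdmissible X T)
    {Y : Finset (Pt d)} (hY : ∀ y ∈ Y, ∃ j, (cube y ∩ Xt j).Nonempty) : NearAdmissible τ Y T := by
  refine ⟨hT.connected, fun y hy => ?_⟩
  obtain ⟨j, q, hqc, hqX⟩ := hY y hy
  obtain ⟨z, hzT, hzX⟩ := hT.meets j
  exact ⟨z, hzT, q, hqc, hdiam j q hqX z (hXt j hzX)⟩

/-- THE GEOMETRIC SENTENCE, REPAIRED (M-units, for every admissible graph): under the thickness threshold 2τ < 1,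
m ≤ 2^d or (1 − 2τ)m ≤ 4·2^d·|T|. [cite: Balaban1988RG2Cluster, p.5 after (1.11)] -/
theorem walkCubes_dichotomy {ι : Type*} {X Xt : ι → Set (RPt d)} {τ : ℝ} (hXt : ∀ j, X j ⊆ Xt j)
    (hdiam : ∀ j, ∀ p ∈ Xt j, ∀ q ∈ Xt j, dist p q ≤ τ) (hτ2 : 2 * τ < 1) {T : List (Seg d)}
    (hT : WAdmissible X T) {Y : Finset (Pt d)} (hY : ∀ y ∈ Y, ∃ j, (cube y ∩ Xt j).Nonempty) :
    Y.card ≤ 2 ^ d ∨ (1 - 2 * τ) * Y.card ≤ 4 * 2 ^ d * len T :=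
  card_dichotomy_of_nearAdmissible (nearAdmissible_of_wAdmissible hXt hdiam hT hY) hτ2

/-- THE GEOMETRIC SENTENCE, REPAIRED (M-units, with the shortest length d(ω)/M = `walkLen X`): under 2τ < 1 and
provided some finite graph meets all the domains, m ≤ 2^d or (1 − 2τ)m ≤ 4·2^d·d(ω)/M.
[cite: Balaban1988RG2Cluster, p.5 after (1.11)] -/
theorem walkCubes_dichotomy_walkLen {ι : Type*} {X Xt : ι → Set (RPt d)} {τ : ℝ} (hXt : ∀ j, X j ⊆ Xt j)
    (hdiam : ∀ j, ∀ p ∈ Xt j, ∀ q ∈ Xt j, dist p q ≤ τ) (hτ2 : 2 * τ < 1) (hne : ∃ T, WAdmissible X T)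
    {Y : Finset (Pt d)} (hY : ∀ y ∈ Y, ∃ j, (cube y ∩ Xt j).Nonempty) :
    Y.card ≤ 2 ^ d ∨ (1 - 2 * τ) * Y.card ≤ 4 * 2 ^ d * walkLen X := by
  by_cases hYc : Y.card ≤ 2 ^ d
  · exact Or.inl hYc
  right
  have hpos : (0 : ℝ) < 4 * 2 ^ d := by positivity
  have hall : ∀ T, WAdmissible X T → (1 - 2 * τ) * Y.card / (4 * 2 ^ d) ≤ len T := by
    intro T hT
    rcases walkCubes_dichotomy hXt hdiam hτ2 hT hY with h | h
    · exact absurd h hYc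
    · rw [div_le_iff₀ hpos]
      linarith
  have := le_walkLen hne hall
  rw [div_le_iff₀ hpos] at this
  linarith

/-- THE |ω| = 0 CASE (*"If m ≦ 2⁴, then we can have short walks, in fact with |ω| = 0"*; the cell's engine part C):
the cubes meeting ONE thickened domain of sup-diameter τ < 1 number at most 2^d, whatever the graph.
[cite: Balaban1988RG2Cluster, p.5 after (1.11)] -/
theorem card_le_two_pow_single {D : Set (RPt d)} {τ : ℝ} (hτ : τ < 1) (hdiam : ∀ p ∈ D, ∀ q ∈ D, dist p q ≤ τ)
    {Y : Finset (Pt d)} (hY : ∀ y ∈ Y, (cube y ∩ D).Nonempty) : Y.card ≤ 2 ^ d :=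
  card_le_two_pow_of_diam hτ hdiam hY

/-! ## Part 4. The repaired sentence in paper units: δ₁, the restriction R1, the factor under the supremum -/

/-- THE CONSTANT δ₁ of the repaired sentence, δ₁ := δ₀(1 − 2τ)/(4·2^d) — OURS, NOT PRINTED ([Balaban1988RG2Cluster]
p. 5 has only *"a positive constant δ₁ depending on δ₀ only"*; here δ₁ depends on δ₀, on d and on the thickness τ
of the domains in M-units). [cite: Balaban1988RG2Cluster, p.5 after (1.11)] -/
def delta1 (d : ℕ) (δ₀ τ : ℝ) : ℝ := δ₀ * (1 - 2 * τ) / (4 * 2 ^ d)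

/-- δ₁ > 0 for δ₀ > 0 under the threshold 2τ < 1. [cite: Balaban1988RG2Cluster, p.5 after (1.11)] -/
theorem delta1_pos {δ₀ τ : ℝ} (hδ₀ : 0 < δ₀) (hτ2 : 2 * τ < 1) : 0 < delta1 d δ₀ τ := by
  unfold delta1
  exact div_pos (mul_pos hδ₀ (by linarith)) (by positivity)

/-- δ₁ ≤ δ₀/(4·2^d) for τ ≥ 0 (the τ → 0 ceiling; d = 4: δ₀/64). [cite: Balaban1988RG2Cluster, p.5 after (1.11)] -/
theorem delta1_le {δ₀ τ : ℝ} (hδ₀ : 0 ≤ δ₀) (hτ : 0 ≤ τ) : delta1 d δ₀ τ ≤ δ₀ / (4 * 2 ^ d) := by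
  unfold delta1
  have hpos : (0 : ℝ) < 4 * 2 ^ d := by positivity
  rw [div_le_div_iff_of_pos_right hpos]
  nlinarith

/-- d = 4: δ₁ = δ₀(1 − 2τ)/64. [cite: Balaban1988RG2Cluster, p.5 after (1.11)] -/
theorem delta1_four (δ₀ τ : ℝ) : delta1 4 δ₀ τ = δ₀ * (1 - 2 * τ) / 64 := by
  unfold delta1
  norm_num

/-- d = 4, τ ≤ 1/6 (e.g. thickened domains of diameter ≤ 15M₁ and 90M₁ ≤ M): δ₁ ≥ δ₀/96 — the cell's constant of
GAPS G-adv4-22 (3) (derived there differently, under 60M₁ < M). [cite: Balaban1988RG2Cluster, p.5 after (1.11)] -/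
theorem delta1_four_sixth {δ₀ τ : ℝ} (hδ₀ : 0 ≤ δ₀) (hτ : τ ≤ 1 / 6) : δ₀ / 96 ≤ delta1 4 δ₀ τ := by
  rw [delta1_four, div_le_div_iff₀ (by norm_num) (by norm_num)]
  nlinarith

/-- d = 4, τ ≤ 1/4 (e.g. thickened domains of diameter ≤ 15M₁ and 60M₁ ≤ M): δ₁ ≥ δ₀/128.
[cite: Balaban1988RG2Cluster, p.5 after (1.11)] -/
theorem delta1_four_quarter {δ₀ τ : ℝ} (hδ₀ : 0 ≤ δ₀) (hτ : τ ≤ 1 / 4) : δ₀ / 128 ≤ delta1 4 δ₀ τ := by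
  rw [delta1_four, div_le_div_iff₀ (by norm_num) (by norm_num)]
  nlinarith

/-- *"If m is big enough, for example m > 2⁴, then δ₀d(ω) ≧ δ₁mM"* — REPAIRED, in paper units (M > 0 the size of the
σ₀-cubes, dω = the length in lattice units, so that dω/M is the M-unit length of the dichotomy): from the dichotomy
and m > 2^d, δ₁mM ≤ δ₀dω with δ₁ = `delta1 d δ₀ τ`. [cite: Balaban1988RG2Cluster, p.5 after (1.11)] -/
theorem ineq111_long {δ₀ M τ dω : ℝ} {m : ℕ} (hδ₀ : 0 ≤ δ₀) (hM : 0 < M)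
    (hdich : m ≤ 2 ^ d ∨ (1 - 2 * τ) * m ≤ 4 * 2 ^ d * (dω / M)) (hm : 2 ^ d < m) :
    delta1 d δ₀ τ * m * M ≤ δ₀ * dω := by
  rcases hdich with h | h
  · exact absurd h (not_le.2 hm)
  · have hpos : (0 : ℝ) < 4 * 2 ^ d := by positivity
    have h' : (1 - 2 * τ) * m * M ≤ 4 * 2 ^ d * dω := by
      have := mul_le_mul_of_nonneg_right h hM.le
      rwa [mul_assoc (4 * 2 ^ d), div_mul_cancel₀ _ hM.ne'] at this
    unfold delta1
    calc δ₀ * (1 - 2 * τ) / (4 * 2 ^ d) * m * M = δ₀ / (4 * 2 ^ d) * ((1 - 2 * τ) * m * M) := by ring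
      _ ≤ δ₀ / (4 * 2 ^ d) * (4 * 2 ^ d * dω) := mul_le_mul_of_nonneg_left h' (by positivity)
      _ = δ₀ * dω := by field_simp

/-- *"we can bound the expression under the supremum in (1.11) by 1, for δ₁M ≧ κ₁"* (long walks, m > 2^d): with
|s(Δ_i)| ≤ e^{κ₁} the factor exp(−δ₀d(ω))·∏_i |s(Δ_i)| ≤ exp(−δ₀d(ω) + mκ₁) ≤ 1 under the restriction R1 = δ₁M ≥ κ₁
(cell census R1, read with δ₁ = `delta1 d δ₀ τ`). [cite: Balaban1988RG2Cluster, p.5 after (1.11)] -/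
theorem supFactor_le_one {δ₀ M τ dω κ₁ : ℝ} {m : ℕ} (hδ₀ : 0 ≤ δ₀) (hM : 0 < M)
    (hdich : m ≤ 2 ^ d ∨ (1 - 2 * τ) * m ≤ 4 * 2 ^ d * (dω / M)) (hm : 2 ^ d < m)
    (hR1 : κ₁ ≤ delta1 d δ₀ τ * M) : Real.exp (-(δ₀ * dω) + m * κ₁) ≤ 1 := by
  have h1 := ineq111_long hδ₀ hM hdich hm
  have h2 : (m : ℝ) * κ₁ ≤ m * (delta1 d δ₀ τ * M) := mul_le_mul_of_nonneg_left hR1 (Nat.cast_nonneg m)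
  rw [← Real.exp_zero]
  exact Real.exp_le_exp.2 (by linarith)

/-- *"If m ≦ 2⁴, then … the expression can be bounded by e^{16κ₁} only"* (short walks): for m ≤ 2^d, κ₁ ≥ 0 and
δ₀dω ≥ 0, exp(−δ₀dω + mκ₁) ≤ e^{2^d κ₁}. [cite: Balaban1988RG2Cluster, p.5 after (1.11)] -/
theorem supFactor_le_short {δ₀ dω κ₁ : ℝ} {m : ℕ} (hδ₀ : 0 ≤ δ₀) (hdω : 0 ≤ dω) (hκ₁ : 0 ≤ κ₁)
    (hm : m ≤ 2 ^ d) : Real.exp (-(δ₀ * dω) + m * κ₁) ≤ Real.exp (2 ^ d * κ₁) := by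
  have hm' : (m : ℝ) ≤ 2 ^ d := by exact_mod_cast hm
  exact Real.exp_le_exp.2 (by nlinarith [mul_nonneg hδ₀ hdω, mul_le_mul_of_nonneg_right hm' hκ₁])

/-- BOTH CASES: under the dichotomy, R1 and κ₁ ≥ 0, the factor under the supremum in (1.11) is ≤ e^{2^d κ₁} — the
printed conclusion *"bounded by B₀e^{16κ₁}|X|"* (d = 4) survives. [cite: Balaban1988RG2Cluster, p.5 after (1.11)] -/
theorem supFactor_le {δ₀ M τ dω κ₁ : ℝ} {m : ℕ} (hδ₀ : 0 ≤ δ₀) (hM : 0 < M) (hdω : 0 ≤ dω) (hκ₁ : 0 ≤ κ₁)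
    (hdich : m ≤ 2 ^ d ∨ (1 - 2 * τ) * m ≤ 4 * 2 ^ d * (dω / M)) (hR1 : κ₁ ≤ delta1 d δ₀ τ * M) :
    Real.exp (-(δ₀ * dω) + m * κ₁) ≤ Real.exp (2 ^ d * κ₁) := by
  rcases le_or_gt m (2 ^ d) with hm | hm
  · exact supFactor_le_short hδ₀ hdω hκ₁ hm
  · refine (supFactor_le_one hδ₀ hM hdich hm hR1).trans ?_
    rw [← Real.exp_zero]
    exact Real.exp_le_exp.2 (by positivity)

/-- THE REPAIRED PARAGRAPH, ASSEMBLED (geometry of Part 3 + arithmetic of Part 4): for a walk whose thickened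
domains have sup-diameter ≤ τM with 2τ < 1, any connected graph T meeting all the domains (length |T| in M-units,
dω = M|T| in lattice units), the m σ₀-cubes meeting the thickened domains, δ₀ ≥ 0, κ₁ ≥ 0 and the restriction
δ₁M ≥ κ₁ with δ₁ = δ₀(1 − 2τ)/(4·2^d): exp(−δ₀·M|T| + mκ₁) ≤ e^{2^d κ₁}.  Since the shortest tree is one such T,
this is the printed use of (1.11) with d(ω) = M·(shortest length). [cite: Balaban1988RG2Cluster, p.5 after (1.11)] -/
theorem ineq111_repaired {ι : Type*} {X Xt : ι → Set (RPt d)} {τ : ℝ} (hXt : ∀ j, X j ⊆ Xt j)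
    (hdiam : ∀ j, ∀ p ∈ Xt j, ∀ q ∈ Xt j, dist p q ≤ τ) (hτ2 : 2 * τ < 1) {T : List (Seg d)}
    (hT : WAdmissible X T) {Y : Finset (Pt d)} (hY : ∀ y ∈ Y, ∃ j, (cube y ∩ Xt j).Nonempty)
    {δ₀ M κ₁ : ℝ} (hδ₀ : 0 ≤ δ₀) (hM : 0 < M) (hκ₁ : 0 ≤ κ₁) (hR1 : κ₁ ≤ delta1 d δ₀ τ * M) :
    Real.exp (-(δ₀ * (M * len T)) + Y.card * κ₁) ≤ Real.exp (2 ^ d * κ₁) := by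
  have hdich := walkCubes_dichotomy hXt hdiam hτ2 hT hY
  have hdich' : Y.card ≤ 2 ^ d ∨ (1 - 2 * τ) * (Y.card : ℝ) ≤ 4 * 2 ^ d * (M * len T / M) := by
    rcases hdich with h | h
    · exact Or.inl h
    · right
      rwa [mul_div_cancel_left₀ _ hM.ne']
  exact supFactor_le hδ₀ hM (mul_nonneg hM.le (len_nonneg T)) hκ₁ hdich' hR1

/-- d = 4: the factor is ≤ e^{16κ₁}, with δ₁ = δ₀(1 − 2τ)/64. [cite: Balaban1988RG2Cluster, p.5 after (1.11)] -/
theorem ineq111_repaired_four {ι : Type*} {X Xt : ι → Set (RPt 4)} {τ : ℝ} (hXt : ∀ j, X j ⊆ Xt j)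
    (hdiam : ∀ j, ∀ p ∈ Xt j, ∀ q ∈ Xt j, dist p q ≤ τ) (hτ2 : 2 * τ < 1) {T : List (Seg 4)}
    (hT : WAdmissible X T) {Y : Finset (Pt 4)} (hY : ∀ y ∈ Y, ∃ j, (cube y ∩ Xt j).Nonempty)
    {δ₀ M κ₁ : ℝ} (hδ₀ : 0 ≤ δ₀) (hM : 0 < M) (hκ₁ : 0 ≤ κ₁) (hR1 : κ₁ ≤ δ₀ * (1 - 2 * τ) / 64 * M) :
    Real.exp (-(δ₀ * (M * len T)) + Y.card * κ₁) ≤ Real.exp (16 * κ₁) := by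
  have h := ineq111_repaired hXt hdiam hτ2 hT hY hδ₀ hM hκ₁ (by rw [delta1_four]; exact hR1)
  have h16 : (2 : ℝ) ^ 4 * κ₁ = 16 * κ₁ := by norm_num
  rwa [h16] at h

/-! ## Part 5. The sentence AS PRINTED (no size threshold) fails: a kernel-checked counterexample -/

/-- The block [0, n]^d (one thickened localization domain X̃₀⁵ made of n^d cubes of size M₁ = M, i.e. R₁ = 1,
which [Balaban1988RG2Cluster] p. 3 admits: *"R₁ is a power of L satisfying the condition R₁M₁M⁻¹ ≦ 1"*).
[cite: Balaban1988RG2Cluster, p.3 (σ₀, R₁)] -/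
def block (d n : ℕ) : Set (RPt d) := Set.Icc 0 (fun _ => (n : ℝ))

/-- The unit cubes meeting the block [0, n]^d: indices in {−1, 0, …, n}^d. [folklore] -/
def blockCubes (d n : ℕ) : Finset (Pt d) := Fintype.piFinset fun _ : Fin d => Finset.Icc (-1 : ℤ) n

/-- |blockCubes d n| = (n + 2)^d. [folklore] -/
theorem card_blockCubes (d n : ℕ) : (blockCubes d n).card = (n + 2) ^ d := by
  rw [blockCubes, Fintype.card_piFinset, Finset.prod_const, Finset.card_univ, Fintype.card_fin, Int.card_Icc]
  have h : ((n : ℤ) + 1 - -1).toNat = n + 2 := by omega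
  rw [h]

/-- The B13 instance d = 4, n = 15 (X₀ = □₀ of 5⁴ M₁-cubes, X̃₀⁵ a 15⁴-block, M₁ = M): 17⁴ = 83521 cubes — the
exact count of the cell's engine `engine_b13_111.py` part B (GAPS G-adv4-22 (2)). [folklore] -/
theorem card_blockCubes_B13 : (blockCubes 4 15).card = 83521 ∧ 2 ^ 4 < (blockCubes 4 15).card := by
  rw [card_blockCubes]
  norm_num

/-- Every cube of `blockCubes d n` meets the block (at the point max(y, 0) coordinatewise). [folklore] -/
theorem blockCubes_meet {n : ℕ} {y : Pt d} (hy : y ∈ blockCubes d n) : (cube y ∩ block d n).Nonempty := by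
  have hyμ : ∀ μ, (-1 : ℤ) ≤ y μ ∧ y μ ≤ n := fun μ => by
    have := Fintype.mem_piFinset.1 hy μ
    rwa [Finset.mem_Icc] at this
  refine ⟨fun μ => max (y μ : ℝ) 0, mem_cube.2 fun μ => ⟨le_max_left _ _, ?_⟩, ?_⟩
  · have h1 : (-1 : ℝ) ≤ y μ := by exact_mod_cast (hyμ μ).1
    exact max_le (by linarith) (by linarith)
  · simp only [block, Set.mem_Icc, Pi.le_def, Pi.zero_apply]
    refine ⟨fun μ => le_max_right _ _, fun μ => max_le ?_ (Nat.cast_nonneg n)⟩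
    exact_mod_cast (hyμ μ).2

/-- The block has sup-diameter ≤ n. [folklore] -/
theorem diam_block (n : ℕ) : ∀ p ∈ block d n, ∀ q ∈ block d n, dist p q ≤ n := by
  intro p hp q hq
  rw [dist_pi_le_iff (Nat.cast_nonneg n)]
  intro μ
  simp only [block, Set.mem_Icc, Pi.le_def, Pi.zero_apply] at hp hq
  rw [Real.dist_eq, abs_le]
  constructor <;> linarith [hp.1 μ, hp.2 μ, hq.1 μ, hq.2 μ]

/-- The one-point graph at the origin (a walk with |ω| = 0 whose tree degenerates to a point). [folklore] -/
def pointGraph (d : ℕ) : List (Seg d) := [((0 : RPt d), (0 : RPt d))]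

/-- Its carrier is {0}. [folklore] -/
@[simp] theorem carrier_pointGraph : carrier (pointGraph d) = {0} := by
  simp [pointGraph]

/-- Its length is 0. [folklore] -/
@[simp] theorem len_pointGraph : len (pointGraph d) = 0 := by
  simp [pointGraph]

/-- The one-point graph is walk-admissible for the one-domain family X₀ = [0, n]^d. [folklore] -/
theorem wAdmissible_pointGraph_block (n : ℕ) : WAdmissible (fun _ : Unit => block d n) (pointGraph d) := by
  refine ⟨by rw [carrier_pointGraph]; exact isConnected_singleton, fun _ => ⟨0, ?_, ?_⟩⟩
  · rw [carrier_pointGraph]; rfl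
  · simp only [block, Set.mem_Icc, le_refl, true_and]
    exact fun μ => Nat.cast_nonneg n

/-- d(ω) = 0 for the one-domain family X₀ = [0, n]^d. [folklore] -/
theorem walkLen_block (n : ℕ) : walkLen (fun _ : Unit => block d n) = 0 :=
  le_antisymm (by simpa using walkLen_le_len (wAdmissible_pointGraph_block (d := d) n)) (walkLen_nonneg _)

/-- THE COUNTEREXAMPLE: for d ≥ 1 and n ≥ 1, the one-domain walk X₀ = X̃₀⁵ = [0, n]^d with the one-point graph
satisfies every hypothesis of `walkCubes_dichotomy` EXCEPT the thickness threshold (here τ = n ≥ 1), and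
m = (n + 2)^d > 2^d cubes carry parameters while the graph has length 0 — so *"m > 2⁴ ⟹ δ₀d(ω) ≧ δ₁mM"* with δ₁ > 0
fails as printed. [cite: Balaban1988RG2Cluster, p.5 after (1.11)] -/
theorem printed111_counterexample (hd : d ≠ 0) {n : ℕ} (hn : 1 ≤ n) :
    (∀ j, (fun _ : Unit => block d n) j ⊆ (fun _ : Unit => block d n) j) ∧
    (Unit → ∀ p ∈ block d n, ∀ q ∈ block d n, dist p q ≤ (n : ℝ)) ∧
    WAdmissible (fun _ : Unit => block d n) (pointGraph d) ∧
    (∀ y ∈ blockCubes d n, ∃ j : Unit, (cube y ∩ (fun _ : Unit => block d n) j).Nonempty) ∧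
    len (pointGraph d) = 0 ∧ walkLen (fun _ : Unit => block d n) = 0 ∧
    (blockCubes d n).card = (n + 2) ^ d ∧ 2 ^ d < (blockCubes d n).card := by
  refine ⟨fun _ => subset_rfl, fun _ => diam_block n, wAdmissible_pointGraph_block n,
    fun y hy => ⟨(), blockCubes_meet hy⟩, len_pointGraph, walkLen_block n, card_blockCubes d n, ?_⟩
  rw [card_blockCubes]
  exact Nat.pow_lt_pow_left (by omega) hd

/-- THE PRINTED SENTENCE FAILS: on the counterexample, for every δ₁ > 0 and every M > 0 the inequality
δ₁mM ≤ δ₀d(ω) is false (d(ω) = 0 < δ₁mM), although m > 2^d. [cite: Balaban1988RG2Cluster, p.5 after (1.11)] -/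
theorem printed111_fails (hd : d ≠ 0) {n : ℕ} (hn : 1 ≤ n) {δ₀ δ₁ M : ℝ} (hδ₁ : 0 < δ₁) (hM : 0 < M) :
    2 ^ d < (blockCubes d n).card ∧
    ¬ (δ₁ * (blockCubes d n).card * M ≤ δ₀ * (M * walkLen (fun _ : Unit => block d n))) := by
  obtain ⟨-, -, -, -, -, hwl, -, hlt⟩ := printed111_counterexample hd hn
  refine ⟨hlt, fun h => ?_⟩
  rw [hwl, mul_zero, mul_zero] at h
  have hpos : (0 : ℝ) < (blockCubes d n).card := by exact_mod_cast lt_of_le_of_lt (Nat.zero_le _) hlt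
  have : 0 < δ₁ * (blockCubes d n).card * M := by positivity
  linarith

/-! ## Part 6. The path reading of [Balaban1985BackgroundPropagators] (3.93) -/

/-- The polygonal path from p through the points of a list, in order ([Balaban1985BackgroundPropagators] (3.93):
*"d(y, y₁) + d(y₁, y₂) + ⋯ + d(y_{n−1}, y_n) + d(y_n, y′)"*). [cite: Balaban1985BackgroundPropagators, p.410 (3.93)] -/
def pathGraph : RPt d → List (RPt d) → List (Seg d)
  | _, [] => []
  | p, q :: l => (p, q) :: pathGraph q l

/-- The (3.93) path length d(p, q₁) + d(q₁, q₂) + ⋯. [cite: Balaban1985BackgroundPropagators, p.410 (3.93)] -/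
def pathLen : RPt d → List (RPt d) → ℝ
  | _, [] => 0
  | p, q :: l => dist p q + pathLen q l

/-- The length of the path graph is the (3.93) sum. [folklore] -/
theorem len_pathGraph : ∀ (p : RPt d) (l : List (RPt d)), len (pathGraph p l) = pathLen p l
  | _, [] => rfl
  | p, q :: l => by rw [pathGraph, pathLen, len_cons, len_pathGraph q l]

/-- Every listed point lies on the path graph. [folklore] -/
theorem mem_carrier_pathGraph : ∀ (p : RPt d) (l : List (RPt d)), ∀ q ∈ l, q ∈ carrier (pathGraph p l)
  | _, [], q, hq => absurd hq List.not_mem_nil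
  | p, q' :: l, q, hq => by
    rw [pathGraph, carrier_cons]
    rcases List.mem_cons.1 hq with rfl | hq
    · exact Or.inl (right_mem_segment ℝ _ _)
    · exact Or.inr (mem_carrier_pathGraph q' l q hq)

/-- The start point lies on the path graph (if the list is non-empty). [folklore] -/
theorem start_mem_carrier_pathGraph (p : RPt d) {l : List (RPt d)} (hl : l ≠ []) : p ∈ carrier (pathGraph p l) := by
  obtain ⟨q, l', rfl⟩ := List.exists_cons_of_ne_nil hl
  rw [pathGraph, carrier_cons]
  exact Or.inl (left_mem_segment ℝ _ _)

/-- The path graph through a non-empty list is connected. [folklore] -/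
theorem isConnected_carrier_pathGraph : ∀ (p : RPt d) {l : List (RPt d)}, l ≠ [] →
    IsConnected (carrier (pathGraph p l))
  | p, [], h => absurd rfl h
  | p, [q], _ => by
    rw [pathGraph, carrier_cons, pathGraph, carrier_nil, Set.union_empty]
    exact ⟨⟨p, left_mem_segment ℝ _ _⟩, (convex_segment p q).isPreconnected⟩
  | p, q :: q' :: l, _ => by
    rw [pathGraph, carrier_cons]
    have ih := isConnected_carrier_pathGraph q (l := q' :: l) (List.cons_ne_nil _ _)
    refine ⟨⟨p, Or.inl (left_mem_segment ℝ _ _)⟩, ?_⟩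
    exact IsPreconnected.union q (right_mem_segment ℝ _ _)
      (start_mem_carrier_pathGraph q (List.cons_ne_nil _ _)) (convex_segment p q).isPreconnected ih.isPreconnected

/-- A (3.93) path whose listed points visit every domain is walk-admissible.
[cite: Balaban1985BackgroundPropagators, p.410 (3.93)] -/
theorem wAdmissible_pathGraph {ι : Type*} {X : ι → Set (RPt d)} (p : RPt d) {l : List (RPt d)} (hl : l ≠ [])
    (h : ∀ j, ∃ q ∈ l, q ∈ X j) : WAdmissible X (pathGraph p l) := by
  refine ⟨isConnected_carrier_pathGraph p hl, fun j => ?_⟩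
  obtain ⟨q, hq, hqX⟩ := h j
  exact ⟨q, mem_carrier_pathGraph p l q hq, hqX⟩

/-- THE DICHOTOMY FOR THE PATH READING: with the (3.93) path (one point y_i in each domain, in walk order, from
any start point y) in place of the tree, m ≤ 2^d or (1 − 2τ)m ≤ 4·2^d·(d(y, y₁) + ⋯)/M — so the repaired sentence
holds for d(ω, y, y′) of [Balaban1985BackgroundPropagators] (3.108) as well as for the tree length of
[Balaban1988RG2Cluster] p. 5. [cite: Balaban1985BackgroundPropagators, p.410 (3.93)] -/
theorem walkCubes_dichotomy_path {ι : Type*} {X Xt : ι → Set (RPt d)} {τ : ℝ} (hXt : ∀ j, X j ⊆ Xt j)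
    (hdiam : ∀ j, ∀ p ∈ Xt j, ∀ q ∈ Xt j, dist p q ≤ τ) (hτ2 : 2 * τ < 1) (p : RPt d) {l : List (RPt d)}
    (hl : l ≠ []) (hvisit : ∀ j, ∃ q ∈ l, q ∈ X j) {Y : Finset (Pt d)}
    (hY : ∀ y ∈ Y, ∃ j, (cube y ∩ Xt j).Nonempty) :
    Y.card ≤ 2 ^ d ∨ (1 - 2 * τ) * Y.card ≤ 4 * 2 ^ d * pathLen p l := by
  rw [← len_pathGraph]
  exact walkCubes_dichotomy hXt hdiam hτ2 (wAdmissible_pathGraph p hl hvisit) hY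

end Literature.MathematicalPhysics.QuantumFieldTheory.Balaban1983to89.B13WalkCubes111

end
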